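import Mathlib
import HarnessLib

/-!
# Crux `NoZenoR` / `NoZeno` (stmt-ResolutionOfSingularities-19943 / -16483), β2 descent, `stub_L1wCore` (F1) route,
# LINK: the residue field of `Spec R` at the closed point is the residue field of the local ring `R`

OURS (cell res-hironaka, chain W4.4; stub worker res-L0-w44-stub-2 g12; glue between the ring-level splitting-base
bundle of res-D-pv-039 (`IsLocalRing.ResidueField`, `κ_B ≃ₐ[κ_A] κ₁`) and the scheme-level hypotheses of BC-2 /
BC-2c (`…NoZenoSplitCountBaseChange`, `…NoZenoSplitCountSplitting`: `(Spec (.of R)).residueField (closedPoint R)`,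
`g.residueFieldMap`)).  Pure Mathlib plumbing; nothing here is a statement of the manuscript under review
(Hironaka 2017); AI-written, weaker than expert review.

* `ΓtoResidueField_apply_eq_zero`, `ΓtoResidueField_surjective_of_isMaximal` — the canonical
  `R → Γ(Spec R) → κ(x)` kills `x` and is onto when `x` is a maximal ideal;
* **`exists_residueFieldIso_of_eq_closedPoint`** — for `R` local and `x = closedPoint R`:
  `κ(x) ≅ IsLocalRing.ResidueField R` compatibly with `R → κ(x)` and `IsLocalRing.residue`;
* `specMap_closedPoint`, `preimage_closedPoint_eq_of_map_maximalIdeal`, `preimage_closedPoint_eq_of_isIntegral` —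
  for a local `R → S`: `Spec S → Spec R` maps the closed point to the closed point, and nothing else lies over it
  when `𝔪_R S = 𝔪_S` or `S` is integral over `R` (the hypothesis `hg` of BC-2);
* **`exists_residueFieldMap_compat`** — the residue field map of `Spec S → Spec R` at the closed point IS
  `IsLocalRing.ResidueField R → IsLocalRing.ResidueField S` under these isomorphisms;
* **`finite_residueFieldMap_closedPoint`, `isSeparable_residueFieldMap_closedPoint`** — hence the hypotheses
  `hfin` / `hsep` of `splitExcCount_pullback_snd` follow from `Module.Finite` / `Algebra.IsSeparable` of
  `ResidueField S` over `ResidueField R`.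
-/

noncomputable section

-- single-problem summit: the doubled namespace component `ResolutionOfSingularities` is forced
set_option linter.dupNamespace false

namespace Summit.ResolutionOfSingularities.ResolutionOfSingularities.Theorems.NoZeno.ExcCount

open CategoryTheory AlgebraicGeometry IsLocalRing

universe u

/-! ## `R → κ(x)` on `Spec R` -/

section Spec

variable (R : Type u) [CommRing R]

/-- `R → Γ(Spec R, 𝒪) → κ(x)` is `R → κ(x.asIdeal)` followed by Mathlib's `Spec.residueFieldIso`. [folklore] -/
theorem ΓtoResidueField_eq (x : Spec (.of R)) :
    (Scheme.ΓSpecIso (.of R)).inv ≫ (Spec (.of R)).Γevaluation x =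
      CommRingCat.ofHom (algebraMap R x.asIdeal.ResidueField) ≫ (Scheme.Spec.residueFieldIso (.of R) x).inv :=
  (Scheme.Spec.algebraMap_residueFieldIso_inv (.of R) x).symm

/-- `R → κ(x)` kills `x`. [folklore] -/
theorem ΓtoResidueField_apply_eq_zero (x : Spec (.of R)) {a : R} (ha : a ∈ x.asIdeal) :
    ((Scheme.ΓSpecIso (.of R)).inv ≫ (Spec (.of R)).Γevaluation x).hom a = 0 := by
  rw [ΓtoResidueField_eq]
  change (Scheme.Spec.residueFieldIso (.of R) x).inv.hom (algebraMap R x.asIdeal.ResidueField a) = 0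
  rw [Ideal.algebraMap_residueField_eq_zero.mpr ha, map_zero]

/-- `R → κ(x)` is onto when `x` is a maximal ideal. [folklore] -/
theorem ΓtoResidueField_surjective_of_isMaximal (x : Spec (.of R)) [x.asIdeal.IsMaximal] :
    Function.Surjective ((Scheme.ΓSpecIso (.of R)).inv ≫ (Spec (.of R)).Γevaluation x).hom := by
  rw [ΓtoResidueField_eq]
  change Function.Surjective ((Scheme.Spec.residueFieldIso (.of R) x).inv.hom ∘
    algebraMap R x.asIdeal.ResidueField)
  exact (Scheme.Spec.residueFieldIso (.of R) x).symm.commRingCatIsoToRingEquiv.surjective.comp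
    (Ideal.algebraMap_residueField_surjective _)

end Spec

/-! ## The closed point of a local ring -/

section ClosedPoint

variable (R : Type u) [CommRing R] [IsLocalRing R]

/-- **`κ(x) ≅ IsLocalRing.ResidueField R` for `x` the closed point of `Spec R`**, `R` local, compatibly with
`R → κ(x)` and `IsLocalRing.residue`. (Stated for any `x = closedPoint R`, e.g. the image of the closed point of a
local `R`-algebra.) [folklore] -/
theorem exists_residueFieldIso_of_eq_closedPoint (x : Spec (.of R)) (hx : x = closedPoint R) :
    ∃ e : (Spec (.of R)).residueField x ≅ CommRingCat.of (ResidueField R),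
      (Scheme.ΓSpecIso (.of R)).inv ≫ (Spec (.of R)).Γevaluation x ≫ e.hom = CommRingCat.ofHom (residue R) := by
  subst hx
  haveI : (closedPoint R).asIdeal.IsMaximal := (maximalIdeal.isMaximal R)
  set t := (Scheme.ΓSpecIso (.of R)).inv ≫ (Spec (.of R)).Γevaluation (closedPoint R) with ht
  -- `t` kills the maximal ideal, so it is a local homomorphism to a field and descends to the residue field
  have hker : ∀ a ∈ maximalIdeal R, t.hom a = 0 := fun a ha =>
    ΓtoResidueField_apply_eq_zero R (closedPoint R) ha
  haveI : IsLocalHom t.hom := by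
    refine ⟨fun a ha => ?_⟩
    by_contra hna
    have h0 : t.hom a = 0 := hker a ((mem_maximalIdeal a).mpr hna)
    exact ha.ne_zero h0
  let ψ : ResidueField R →+* (Spec (.of R)).residueField (closedPoint R) := ResidueField.lift t.hom
  have hψ : ∀ r, ψ (residue R r) = t.hom r := fun r => ResidueField.lift_residue_apply _ r
  have hψbij : Function.Bijective ψ := by
    refine ⟨ψ.injective, fun c => ?_⟩
    obtain ⟨r, hr⟩ := ΓtoResidueField_surjective_of_isMaximal R (closedPoint R) c
    exact ⟨residue R r, (hψ r).trans hr⟩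
  let e : (Spec (.of R)).residueField (closedPoint R) ≅ CommRingCat.of (ResidueField R) :=
    ((RingEquiv.ofBijective ψ hψbij).symm).toCommRingCatIso
  refine ⟨e, ?_⟩
  ext r
  change (RingEquiv.ofBijective ψ hψbij).symm (t.hom r) = residue R r
  rw [RingEquiv.symm_apply_eq, RingEquiv.ofBijective_apply, hψ]

end ClosedPoint

/-! ## A local homomorphism of local rings -/

section LocalHom

variable (R S : Type u) [CommRing R] [CommRing S] [IsLocalRing R] [IsLocalRing S] [Algebra R S]
  [IsLocalHom (algebraMap R S)]

/-- `Spec S → Spec R` maps the closed point to the closed point. [folklore] -/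
theorem specMap_closedPoint :
    (Spec.map (CommRingCat.ofHom (algebraMap R S))).base (closedPoint S) = closedPoint R :=
  IsLocalRing.comap_closedPoint (algebraMap R S)

/-- If `𝔪_R S = 𝔪_S`, the closed point is the only point of `Spec S` over the closed point of `Spec R`
(hypothesis `hg` of `splitExcCount_pullback_snd`). [folklore] -/
theorem preimage_closedPoint_eq_of_map_maximalIdeal (h : (maximalIdeal R).map (algebraMap R S) = maximalIdeal S) :
    (Spec.map (CommRingCat.ofHom (algebraMap R S))).base ⁻¹' {closedPoint R} = {closedPoint S} := by
  ext q
  simp only [Set.mem_preimage]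
  constructor
  · intro hq
    have hq' : q.asIdeal.comap (algebraMap R S) = maximalIdeal R := by
      have := congrArg PrimeSpectrum.asIdeal hq
      exact this
    have hle : maximalIdeal S ≤ q.asIdeal := by
      rw [← h, Ideal.map_le_iff_le_comap, hq']
    exact PrimeSpectrum.ext ((maximalIdeal.isMaximal S).eq_of_le q.2.ne_top hle).symm
  · rintro rfl
    exact specMap_closedPoint R S

/-- If `S` is integral over `R` (e.g. finite), the closed point is the only point of `Spec S` over the closed point
of `Spec R`. [folklore] -/
theorem preimage_closedPoint_eq_of_isIntegral [Algebra.IsIntegral R S] :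
    (Spec.map (CommRingCat.ofHom (algebraMap R S))).base ⁻¹' {closedPoint R} = {closedPoint S} := by
  ext q
  simp only [Set.mem_preimage]
  constructor
  · intro hq
    have hq' : q.asIdeal.comap (algebraMap R S) = maximalIdeal R := congrArg PrimeSpectrum.asIdeal hq
    haveI : (q.asIdeal.comap (algebraMap R S)).IsMaximal := hq' ▸ maximalIdeal.isMaximal R
    have hmax : q.asIdeal.IsMaximal :=
      Ideal.isMaximal_of_isIntegral_of_isMaximal_comap (R := R) q.asIdeal inferInstance
    exact PrimeSpectrum.ext (IsLocalRing.eq_maximalIdeal hmax)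
  · rintro rfl
    exact specMap_closedPoint R S

/-- **The residue field map of `Spec S → Spec R` at the closed point is `κ(R) → κ(S)`**: there are isomorphisms
`κ(g 𝔪_S) ≅ ResidueField R`, `κ(𝔪_S) ≅ ResidueField S` (those of `exists_residueFieldIso_of_eq_closedPoint`) carrying
`g.residueFieldMap 𝔪_S` to the algebra map `ResidueField R → ResidueField S`. [folklore] -/
theorem exists_residueFieldMap_compat :
    ∃ (eR : (Spec (.of R)).residueField ((Spec.map (CommRingCat.ofHom (algebraMap R S))).base (closedPoint S)) ≅
        CommRingCat.of (ResidueField R))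
      (eS : (Spec (.of S)).residueField (closedPoint S) ≅ CommRingCat.of (ResidueField S)),
      (Spec.map (CommRingCat.ofHom (algebraMap R S))).residueFieldMap (closedPoint S) ≫ eS.hom =
        eR.hom ≫ CommRingCat.ofHom (algebraMap (ResidueField R) (ResidueField S)) := by
  set g := Spec.map (CommRingCat.ofHom (algebraMap R S)) with hg
  obtain ⟨eR, heR⟩ := exists_residueFieldIso_of_eq_closedPoint R (g.base (closedPoint S)) (specMap_closedPoint R S)
  obtain ⟨eS, heS⟩ := exists_residueFieldIso_of_eq_closedPoint S (closedPoint S) rfl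
  refine ⟨eR, eS, ?_⟩
  -- both sides agree after the surjection `R → κ(g 𝔪_S)`
  haveI : (g.base (closedPoint S)).asIdeal.IsMaximal := by
    rw [specMap_closedPoint R S]; exact maximalIdeal.isMaximal R
  have hsurj := ΓtoResidueField_surjective_of_isMaximal R (g.base (closedPoint S))
  have h1 : (Scheme.ΓSpecIso (.of R)).inv ≫ (Spec (.of R)).Γevaluation (g.base (closedPoint S)) ≫
      g.residueFieldMap (closedPoint S) ≫ eS.hom = CommRingCat.ofHom ((residue S).comp (algebraMap R S)) := by
    rw [Scheme.Γevaluation_naturality_assoc, hg, ← Scheme.ΓSpecIso_inv_naturality_assoc, heS]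
    rfl
  have h2 : (Scheme.ΓSpecIso (.of R)).inv ≫ (Spec (.of R)).Γevaluation (g.base (closedPoint S)) ≫
      eR.hom ≫ CommRingCat.ofHom (algebraMap (ResidueField R) (ResidueField S)) =
      CommRingCat.ofHom ((residue S).comp (algebraMap R S)) := by
    rw [reassoc_of% heR]
    rfl
  ext c
  obtain ⟨r, rfl⟩ := hsurj c
  have h1' := congrArg (fun φ => φ.hom r) h1
  have h2' := congrArg (fun φ => φ.hom r) h2
  simp only [CommRingCat.hom_comp, RingHom.comp_apply] at h1' h2'
  change (g.residueFieldMap (closedPoint S) ≫ eS.hom).hom _ = (eR.hom ≫ _).hom _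
  simp only [CommRingCat.hom_comp, RingHom.comp_apply]
  rw [h1', h2']

/-- **`hfin` of BC-2 from the ring level**: `κ(𝔪_S)` is finite over `κ(g 𝔪_S)` (through `g.residueFieldMap`) as soon
as `ResidueField S` is finite over `ResidueField R`. [this work] -/
theorem finite_residueFieldMap_closedPoint [Module.Finite (ResidueField R) (ResidueField S)] :
    letI := ((Spec.map (CommRingCat.ofHom (algebraMap R S))).residueFieldMap (closedPoint S)).hom.toAlgebra
    Module.Finite ((Spec (.of R)).residueField ((Spec.map (CommRingCat.ofHom (algebraMap R S))).base
      (closedPoint S))) ((Spec (.of S)).residueField (closedPoint S)) := by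
  obtain ⟨eR, eS, h⟩ := exists_residueFieldMap_compat R S
  letI := ((Spec.map (CommRingCat.ofHom (algebraMap R S))).residueFieldMap (closedPoint S)).hom.toAlgebra
  refine Module.Finite.of_equiv_equiv eR.symm.commRingCatIsoToRingEquiv eS.symm.commRingCatIsoToRingEquiv ?_
  ext a
  -- `g.rfm (eR⁻¹ a) = eS⁻¹ (algebraMap a)` from `g.rfm ≫ eS = eR ≫ algebraMap`
  change ((Spec.map (CommRingCat.ofHom (algebraMap R S))).residueFieldMap (closedPoint S)).hom (eR.inv.hom a) =
    eS.inv.hom (algebraMap (ResidueField R) (ResidueField S) a)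
  have h' := congrArg (fun φ => (φ ≫ eS.inv).hom (eR.inv.hom a)) h
  simp only [Category.assoc, Iso.hom_inv_id, Category.comp_id, CommRingCat.hom_comp, RingHom.comp_apply,
    Iso.inv_hom_id_apply] at h'
  rw [h']
  rfl

/-- **`hsep` of BC-2 from the ring level**: `κ(𝔪_S)/κ(g 𝔪_S)` is separable as soon as
`ResidueField S / ResidueField R` is. [this work] -/
theorem isSeparable_residueFieldMap_closedPoint [Algebra.IsSeparable (ResidueField R) (ResidueField S)] :
    letI := ((Spec.map (CommRingCat.ofHom (algebraMap R S))).residueFieldMap (closedPoint S)).hom.toAlgebra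
    Algebra.IsSeparable ((Spec (.of R)).residueField ((Spec.map (CommRingCat.ofHom (algebraMap R S))).base
      (closedPoint S))) ((Spec (.of S)).residueField (closedPoint S)) := by
  obtain ⟨eR, eS, h⟩ := exists_residueFieldMap_compat R S
  letI := ((Spec.map (CommRingCat.ofHom (algebraMap R S))).residueFieldMap (closedPoint S)).hom.toAlgebra
  refine Algebra.IsSeparable.of_equiv_equiv eR.symm.commRingCatIsoToRingEquiv eS.symm.commRingCatIsoToRingEquiv
    ?_
  ext a
  change ((Spec.map (CommRingCat.ofHom (algebraMap R S))).residueFieldMap (closedPoint S)).hom (eR.inv.hom a) =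
    eS.inv.hom (algebraMap (ResidueField R) (ResidueField S) a)
  have h' := congrArg (fun φ => (φ ≫ eS.inv).hom (eR.inv.hom a)) h
  simp only [Category.assoc, Iso.hom_inv_id, Category.comp_id, CommRingCat.hom_comp, RingHom.comp_apply,
    Iso.inv_hom_id_apply] at h'
  rw [h']
  rfl

end LocalHom

end Summit.ResolutionOfSingularities.ResolutionOfSingularities.Theorems.NoZeno.ExcCount

end
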